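import Mathlib
import Literature.AlgebraicGeometry.Resolution.NormalizationOfVarieties
import Literature.AlgebraicGeometry.Resolution.AlterationsNormalizationReduction
import Summits.ResolutionOfSingularities.ResolutionOfSingularities.Theorems.WildQuotientsWildQuotientResolutionIntegralClosureFiniteType
import Summits.ResolutionOfSingularities.ResolutionOfSingularities.Theorems.WildQuotientsWildQuotientResolutionPhaseZeroReduction
import HarnessLib

/-!
# Finiteness of relative normalisation over a field — hypothesis (H2) of the Phase-0 reduction DISCHARGED
# (crux `WildQuotients.WildQuotientResolution`, stub `stub_phaseZeroHighDim`)

Crux stmt-ResolutionOfSingularities-15640 (`WildQuotientResolution`), registered stub `stub_phaseZeroHighDim`.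
✓`PhaseZeroReduction.phaseZero_conclusion_of_equivariantRegularModels` derives the VERBATIM conclusion of the
stub from (H1) Abbes–Saito 2011 Prop. 2.22 (typed named fact), (H2) finiteness of relative normalisation over
`k` (an explicit `∀`-hypothesis `hfin`) and (H3) equivariant regular models of the equivariant models of `X′`.
This file PROVES (H2):

**Theorem** (`isFinite_fromNormalization_of_isIntegral`). For a field `k`, a `k`-scheme `Q` locally of
finite type, an INTEGRAL scheme `V` and a quasi-compact quasi-separated `g : V → Q` locally of finite type,
the relative normalisation `Q^ν(g) → Q` of `Q` in `V` (Mathlib `g.fromNormalization`) is FINITE.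

Proof: affine-locally on `Q` (✓`Resolution.isFinite_fromNormalization_of_finite`) the claim is that the
integral closure of `A = Γ(Q, U)` in `B = Γ(V, g⁻¹U)` is a finite `A`-module; `B` embeds into the finitely
generated `k`-domain `Γ(V, W₁)` of any non-empty affine open `W₁ ⊆ g⁻¹U` (`V` integral), so this is
✓`IntegralClosureFiniteType.module_finite_integralClosure_of_injective` (E. Noether + finiteness of the
relative algebraic closure); over an empty `g⁻¹U` the ring of sections is trivial.

Consequently the formal census of the stub loses (H2): `phaseZero_conclusion_of_equivariantRegularModels'`
(conclusion of `stub_phaseZeroHighDim` from (H1) + (H3) only) and `exists_normalModel_of_isRegular'` (the normal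
Phase-0 model with p-closed inertia, conditional on (H1) only).

[OURS · crux stmt-ResolutionOfSingularities-15640 · helper toward `stub_phaseZeroHighDim` (discharge of
hypothesis (H2) of the conditional reduction; NOT a proof of the stub, whose residual (H3) is open);
counted 0; AI-level work, weaker than expert review.]
-/

-- single-problem summit: the doubled namespace component `ResolutionOfSingularities` is forced
set_option linter.dupNamespace false

noncomputable section

open CategoryTheory CategoryTheory.Limits AlgebraicGeometry TopologicalSpace Opposite
open Literature.AlgebraicGeometry.Ramification Literature.AlgebraicGeometry.Resolution

namespace Summit.ResolutionOfSingularities.ResolutionOfSingularities.Theorems.WildQuotientResolution.FromNormalizationFinite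

universe u

/-- For `s : Q → Spec k` locally of finite type and an affine open `U ⊆ Q`, the structure map
`k → Γ(Q, U)` is of finite type. [folklore] -/
theorem finiteType_sectionsHom {k : Type u} [Field k] {Q : Scheme.{u}} (s : Q ⟶ Spec (.of k))
    [LocallyOfFiniteType s] (U : Q.affineOpens) :
    ((s.appLE ⊤ U le_top).hom.comp (Scheme.ΓSpecIso (.of k)).inv.hom).FiniteType := by
  refine RingHom.FiniteType.comp ?_ (RingHom.FiniteType.of_surjective _
    (Scheme.ΓSpecIso (.of k)).symm.commRingCatIsoToRingEquiv.surjective)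
  exact HasRingHomProperty.appLE @LocallyOfFiniteType s ‹_› ⟨⊤, isAffineOpen_top _⟩ U le_top

/-- Affine-local form of (H2): for `V` integral and `g : V → Q`, `s : Q → Spec k` locally of finite type,
the integral closure of `Γ(Q, U)` in `Γ(V, g⁻¹U)` is a finite `Γ(Q, U)`-module for every affine open
`U ⊆ Q`. [folklore] -/
theorem module_finite_integralClosure_sections {k : Type u} [Field k] {V Q : Scheme.{u}} (g : V ⟶ Q)
    [IsIntegral V] (s : Q ⟶ Spec (.of k)) [LocallyOfFiniteType s] [LocallyOfFiniteType g]
    (U : Q.affineOpens) :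
    letI := (g.app U).hom.toAlgebra
    Module.Finite Γ(Q, U) (integralClosure Γ(Q, U) Γ(V, g ⁻¹ᵁ U)) := by
  letI := (g.app U).hom.toAlgebra
  -- `k`-algebra structure on `Γ(Q, U)`, of finite type
  let φ : k →+* Γ(Q, U) := (s.appLE ⊤ U le_top).hom.comp (Scheme.ΓSpecIso (.of k)).inv.hom
  letI : Algebra k Γ(Q, U) := φ.toAlgebra
  haveI : Algebra.FiniteType k Γ(Q, U) := finiteType_sectionsHom s U
  by_cases hW : ((g ⁻¹ᵁ U : V.Opens) : Set V).Nonempty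
  · -- a non-empty affine open `W₁ ⊆ g⁻¹U`
    obtain ⟨x, hx⟩ := hW
    obtain ⟨_, ⟨W₁, hW₁, rfl⟩, hxW₁, hW₁le⟩ :=
      V.isBasis_affineOpens.exists_subset_of_mem_open hx (g ⁻¹ᵁ U).isOpen
    haveI : Nonempty W₁ := ⟨⟨x, hxW₁⟩⟩
    let φ₁ : k →+* Γ(V, W₁) :=
      ((g ≫ s).appLE ⊤ W₁ le_top).hom.comp (Scheme.ΓSpecIso (.of k)).inv.hom
    letI : Algebra k Γ(V, W₁) := φ₁.toAlgebra
    haveI : Algebra.FiniteType k Γ(V, W₁) := finiteType_sectionsHom (g ≫ s) ⟨W₁, hW₁⟩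
    let ι : Γ(V, g ⁻¹ᵁ U) →+* Γ(V, W₁) := (V.presheaf.map (homOfLE hW₁le).op).hom
    have hι : Function.Injective ι := presheaf_map_injective_of_isIntegral hW₁le
    refine IntegralClosureFiniteType.module_finite_integralClosure_of_injective k Γ(V, W₁) Γ(Q, U)
      Γ(V, g ⁻¹ᵁ U) ι hι ?_
    -- compatibility of the `k`-structures: `k → Γ(Q,U) → Γ(V,g⁻¹U) → Γ(V,W₁)` is `k → Γ(V,W₁)`
    ext a
    change (V.presheaf.map (homOfLE hW₁le).op).hom ((g.app U).hom ((s.appLE ⊤ U le_top).hom _)) =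
      ((g ≫ s).appLE ⊤ W₁ le_top).hom _
    rw [← Scheme.Hom.appLE_comp_appLE g s ⊤ U W₁ le_top hW₁le]
    rfl
  · -- `g⁻¹U = ∅`: the ring of sections is trivial
    have hbot : (g ⁻¹ᵁ U : V.Opens) = ⊥ :=
      Opens.ext ((Set.not_nonempty_iff_eq_empty.mp hW).trans Opens.coe_bot.symm)
    haveI : Subsingleton Γ(V, g ⁻¹ᵁ U) :=
      CommRingCat.subsingleton_of_isTerminal (V.sheaf.isTerminalOfEqEmpty hbot)
    infer_instance

/-- **(H2) is a theorem: the relative normalisation of a `k`-scheme locally of finite type in an integral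
scheme locally of finite type over it is FINITE.** For a field `k`, `s : Q → Spec k` locally of finite type,
`V` integral and `g : V → Q` quasi-compact, quasi-separated and locally of finite type, Mathlib's
`g.fromNormalization : Q^ν(g) → Q` is a finite morphism. [cite: Liu2002, Prop. 4.1.27]
[cite: StacksProject, Tag 035I] -/
theorem isFinite_fromNormalization_of_isIntegral {k : Type u} [Field k] {V Q : Scheme.{u}} (g : V ⟶ Q)
    [QuasiCompact g] [QuasiSeparated g] [IsIntegral V] (s : Q ⟶ Spec (.of k)) [LocallyOfFiniteType s]
    [LocallyOfFiniteType g] : IsFinite g.fromNormalization :=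
  isFinite_fromNormalization_of_finite g (fun U : Q.affineOpens => U) (iSup_affineOpens_eq_top Q)
    fun U => module_finite_integralClosure_sections g s U

/-- **The normal Phase-0 model, now conditional on (H1) Abbes–Saito 2011 Prop. 2.22 ONLY** (hypothesis (H2)
of ✓`PhaseZeroNormalModel.exists_normalModel_of_isRegular` discharged by
`isFinite_fromNormalization_of_isIntegral`): for the crux data with `X′` regular, an integral `Xs` with a
`G`-action and a PROPER, BIRATIONAL, `G`-EQUIVARIANT `πs : Xs → X′` with p-closed inertia everywhere and a
`G`-stable affine cover — every clause of `stub_phaseZeroHighDim` except `Scheme.IsRegular Xs`.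
[cite: AbbesSaito2011, Prop. 2.22 (NS4)] [cite: Liu2002, Prop. 4.1.27] -/
theorem exists_normalModel_of_isRegular'
    (hAS : AbbesSaito2011_inertiaNormalSylow_after_admissibleBlowup.{0})
    (ℓ : ℕ) [Fact ℓ.Prime] (k : Type) [Field k] [CharP k ℓ]
    (X' X₁ : Scheme.{0}) (f : X₁ ⟶ Spec (.of k)) (q : X' ⟶ X₁) (G : Type) [Group G] [Finite G]
    (ρ : G →* Aut X') (hfaith : Function.Injective ρ)
    [IsSeparated f] [LocallyOfFiniteType f] [QuasiCompact f] [IsIntegral X'] (hreg : Scheme.IsRegular X')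
    [IsFinite q] (hρ : ∀ g : G, (ρ g).hom ≫ q = q) :
    ∃ (Xs : Scheme.{0}) (πs : Xs ⟶ X') (ρs : G →* Aut Xs),
      IsIntegral Xs ∧ IsProper πs ∧ IsBirational πs ∧
      (∀ g : G, (ρs g).hom ≫ πs = πs ≫ (ρ g).hom) ∧
      (∀ x : Xs, HasNormalSylow ℓ (inertiaSubgroup ρs x)) ∧
      ∀ x : Xs, ∃ U : Xs.Opens, IsAffineOpen U ∧ x ∈ U ∧ ∀ g : G, (ρs g).hom ⁻¹ᵁ U = U :=
  PhaseZeroNormalModel.exists_normalModel_of_isRegular hAS ℓ k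
    (fun _ _ g _ _ _ s _ _ => isFinite_fromNormalization_of_isIntegral g s) X' X₁ f q G ρ hfaith hreg hρ

/-- **`stub_phaseZeroHighDim`'s conclusion from (H1) Abbes–Saito 2011 Prop. 2.22 and (H3) equivariant regular
models of the equivariant models of `X′` ALONE** — hypothesis (H2) of
✓`PhaseZeroReduction.phaseZero_conclusion_of_equivariantRegularModels` is discharged by
`isFinite_fromNormalization_of_isIntegral`. The conclusion is verbatim that of the registered stub; (H1) is a
theorem in print, (H3) (equivariant resolution of the models of the regular `X′`) is the open residual.
[cite: AbbesSaito2011, Prop. 2.22 (NS4)] [cite: Liu2002, Prop. 4.1.27] -/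
theorem phaseZero_conclusion_of_equivariantRegularModels'
    (hAS : AbbesSaito2011_inertiaNormalSylow_after_admissibleBlowup.{0})
    (p : ℕ) (hp : p.Prime) (k : Type) [Field k] [CharP k p]
    (X' X₁ : Scheme.{0}) (f : X₁ ⟶ Spec (.of k)) (q : X' ⟶ X₁) (G : Type) [Group G] [Finite G]
    (ρ : G →* Aut X') (hfaith : Function.Injective ρ)
    [IsSeparated f] [LocallyOfFiniteType f] [QuasiCompact f] [IsIntegral X'] (hreg : Scheme.IsRegular X')
    [IsFinite q] (hρ : ∀ g : G, (ρ g).hom ≫ q = q)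
    (hres : ∀ (Xs : Scheme.{0}) (πs : Xs ⟶ X') (ρs : G →* Aut Xs), IsIntegral Xs → IsProper πs →
      IsBirational πs → (∀ g : G, (ρs g).hom ≫ πs = πs ≫ (ρ g).hom) →
      ∃ (Xr : Scheme.{0}) (πr : Xr ⟶ Xs) (ρr : G →* Aut Xr), IsProper πr ∧ IsBirational πr ∧
        IsIntegral Xr ∧ Scheme.IsRegular Xr ∧ (∀ g : G, (ρr g).hom ≫ πr = πr ≫ (ρs g).hom) ∧
        ∀ x : Xr, ∃ U : Xr.Opens, IsAffineOpen U ∧ x ∈ U ∧ ∀ g : G, (ρr g).hom ⁻¹ᵁ U = U) :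
    ∃ (Xs : Scheme.{0}) (π : Xs ⟶ X') (ρs : G →* Aut Xs), IsProper π ∧ IsBirational π ∧
      IsIntegral Xs ∧ Scheme.IsRegular Xs ∧ (∀ g : G, (ρs g).hom ≫ π = π ≫ (ρ g).hom) ∧
      (∀ x : Xs, HasNormalSylow p (inertiaSubgroup ρs x)) ∧
      ∀ x : Xs, ∃ U : Xs.Opens, IsAffineOpen U ∧ x ∈ U ∧ ∀ g : G, (ρs g).hom ⁻¹ᵁ U = U :=
  PhaseZeroReduction.phaseZero_conclusion_of_equivariantRegularModels hAS p hp k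
    (fun _ _ g _ _ _ s _ _ => isFinite_fromNormalization_of_isIntegral g s) X' X₁ f q G ρ hfaith hreg hρ
    hres

/-- **The normal Phase-0 model for `X′` merely NORMAL, conditional on (H1) Abbes–Saito 2011 Prop. 2.22 ONLY**
(hypothesis (H2) of ✓`PhaseZeroNormalModel.exists_normalModel_isProper_forall_hasNormalSylow` discharged by
`isFinite_fromNormalization_of_isIntegral`): an integral `Xs` with a `G`-action and a PROPER, BIRATIONAL,
`G`-EQUIVARIANT `πs : Xs → X′` with p-closed inertia everywhere and a `G`-stable affine cover.
[cite: AbbesSaito2011, Prop. 2.22 (NS4)] [cite: Liu2002, Prop. 4.1.27] -/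
theorem exists_normalModel_isProper_forall_hasNormalSylow'
    (hAS : AbbesSaito2011_inertiaNormalSylow_after_admissibleBlowup.{0})
    (ℓ : ℕ) [Fact ℓ.Prime] (k : Type) [Field k] [CharP k ℓ]
    (X' X₁ : Scheme.{0}) (f : X₁ ⟶ Spec (.of k)) (q : X' ⟶ X₁) (G : Type) [Group G] [Finite G]
    (ρ : G →* Aut X') (hfaith : Function.Injective ρ)
    [IsSeparated f] [LocallyOfFiniteType f] [QuasiCompact f] [IsIntegral X'] [IsFinite q]
    (hnorm : ∀ x : X', IsIntegrallyClosed (X'.presheaf.stalk x))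
    (hρ : ∀ g : G, (ρ g).hom ≫ q = q) :
    ∃ (Xs : Scheme.{0}) (πs : Xs ⟶ X') (ρs : G →* Aut Xs),
      IsIntegral Xs ∧ IsProper πs ∧ IsBirational πs ∧
      (∀ g : G, (ρs g).hom ≫ πs = πs ≫ (ρ g).hom) ∧
      (∀ x : Xs, HasNormalSylow ℓ (inertiaSubgroup ρs x)) ∧
      ∀ x : Xs, ∃ U : Xs.Opens, IsAffineOpen U ∧ x ∈ U ∧ ∀ g : G, (ρs g).hom ⁻¹ᵁ U = U :=
  PhaseZeroNormalModel.exists_normalModel_isProper_forall_hasNormalSylow hAS ℓ k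
    (fun _ _ g _ _ _ s _ _ => isFinite_fromNormalization_of_isIntegral g s) X' X₁ f q G ρ hfaith hnorm hρ

end Summit.ResolutionOfSingularities.ResolutionOfSingularities.Theorems.WildQuotientResolution.FromNormalizationFinite

end
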